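import Mathlib
import HarnessLib

/-!
# Peyrl–Parrilo rounding-and-projection: the projected Gram matrix is exactly feasible, nearest,
# and positive semidefinite under the margin inequality `τ² + δ² ≤ ε²` (Peyrl–Parrilo 2008, §3)

Topic `Computation/Certificates`; fifteen public theorems (plus sixteen private trace-form plumbing lemmas), three
plumbing definitions (`frob`, `proj`, `NormalEq`), two worked `example`s over `ℚ`, no named fact (everything here is
PROVED), no instance, no `sorry`.

This is the PRODUCER-side step that the certificate files of this topic deliberately leave out
(`GramSOS` — "after the Peyrl–Parrilo rounding/projection step (`Q` exact …)"; `PosSemidef` — "the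
rounding/projection procedure that produces such certificates in practice"; `SumOfSquares` — "No SDP
solver, no rounding/projection step"): how an EXACT rational positive-semidefinite Gram matrix satisfying
the affine (coefficient-matching) constraints EXACTLY is obtained from a strictly feasible NUMERICAL SDP
solution, and why that always succeeds with enough digits.  SOURCE (read from the held text,
`paper:doi-10-1016-j-tcs-2008-09-025`): H. Peyrl, P. A. Parrilo, *Computing sum of squares decompositions
with rational coefficients*, Theoret. Comput. Sci. 409 (2008) 269–281, §3.1 "Kernel representation",
p. 276: the numerical Gram matrix `Q` is rounded to a rational `Q̃` (`d(Q, Q̃) ≤ τ`) and `Q̃` is projected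
ORTHOGONALLY (trace / Frobenius inner product) onto the affine space `L = {X : ⟪A_k, X⟫ = b_k ∀ k}` cut
out by the rational constraint data; **Proposition 7** gives the projection in closed form ("obtained by
just subtracting the weighted errors of the coefficients from the Gram matrix … `Π(Q)` will be a rational
matrix if `Q` and `p` are rational"), and **Proposition 8**: "Let `ε`, `δ`, and `τ` be defined as above"
(`Q ⪰ ε·I`, `d(Q, Π(Q)) ≤ δ`, `d(Q, Q̃) ≤ τ`). "Assume `τ² + δ² ≤ ε²`. Then, the orthogonal projection of
the rounded matrix `Q̃` on the affine subspace `L` is positive semidefinite, and thus it is a valid SOS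
decomposition."  Its proof (p. 276): Pythagoras `d(Π(Q̃), Q)² = d(Q, Π(Q))² + d(Π(Q̃), Π(Q))²`,
non-expansiveness `d(Π(Q̃), Π(Q)) ≤ d(Q̃, Q)`, and `|λ_i(E)| ≤ d(E, 0)` for `E = Π(Q̃) − Q`, whence
`Π(Q̃) ⪰ (ε − √(δ² + τ²))·I ⪰ 0`.  §3.2 "Image representation", p. 277, **Proposition 9**: for
`Q(y) = G₀ + Σ yᵢ Gᵢ ⪰ ε·I` and a rational `ỹ` with `|yᵢ − ỹᵢ| ≤ τ`, `τ ≤ ε / Σᵢ σ̄(Gᵢ)`, "the rational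
approximation `ỹ` will yield an exact SOS decomposition" (`Q(ỹ) ⪰ 0`; identity (3) holds for every `ỹ`).
[cite: PeyrlParrilo2008, §3.1 Propositions 7–8, p. 276; §3.2 Proposition 9, p. 277]

What is proved here, for matrices over an arbitrary FIELD `𝕜` indexed by finite types (the algebra) and
over a LINEARLY ORDERED field (the inequalities) — so that every statement specialises to `ℚ`, where the
producer actually computes, as well as to `ℝ`, where the paper argues; no square root, eigenvalue or norm
is ever taken (the paper's `d(·,·)²` is the trace form `frob (X − Y) (X − Y)`, its `Q ⪰ ε·I` the
quadratic-form margin `ε·Σ vᵢ² ≤ vᵀQv`, its `|λ_i(E)| ≤ d(E,0)` the Cauchy–Schwarz surrogate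
`(vᵀEv)² ≤ ‖E‖_F² (Σ vᵢ²)²`):

* `proj A Q μ = Q − Σ_l μ_l • A_l` with `μ` ANY solution of the normal equations
  `NormalEq A b Q μ : ∀ k, Σ_l μ_l ⟪A_k, A_l⟫ = ⟪A_k, Q⟫ − b_k` (the producer solves this `|ι| × |ι|`
  rational linear system; for a trace-orthogonal constraint family — the coefficient-matching basis of an
  SOS program, where `⟪A_γ, A_γ⟫ = n(γ)` counts the exponent pairs summing to `γ` — it is DIAGONAL and
  `normalEq_of_orthogonal` is exactly Proposition 7's "subtract the error `e_γ` divided by `n(γ)`");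
* `frob_constraint_proj` — `Π(Q)` satisfies every constraint EXACTLY (Prop. 7: feasibility by construction);
* `frob_sub_proj_orthogonal`, `pythagoras`, `frobSq_proj_le` — `Q − Π(Q) ⟂ L`, Pythagoras, and `Π(Q)` is
  the NEAREST point of `L` in the trace form (this is what makes `proj` "the orthogonal projection `Π`");
* `frobSq_proj_sub_proj_le` — non-expansiveness `d(Π(Q̃), Π(Q)) ≤ d(Q̃, Q)` (the step "Clearly, …");
* `sq_dotProduct_mulVec_le`, `abs_dotProduct_mulVec_le` — `(vᵀEv)² ≤ ⟪E,E⟫ (Σvᵢ²)²`, the exact stand-in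
  for `|λ_i(E)| ≤ d(E, 0)`;
* `dotProduct_mulVec_nonneg_of_margin` — `Q ⪰ ε·I ∧ d(Q', Q)² ≤ ε² ⇒ Q' ⪰ 0` (as quadratic forms);
* `proposition8` — the statement quoted above, conclusion `Π(Q̃)` feasible ∧ `vᵀ Π(Q̃) v ≥ 0 ∀ v`, and
  `posSemidef_proj` — the same as Mathlib's `Matrix.PosSemidef` when `Q̃` and the `A_k` are symmetric;
* `proposition9` — the image-representation bound, with the spectral radius `σ̄(Gᵢ)` replaced by ANY
  certified bound `sᵢ` on `|vᵀGᵢv| / Σvᵢ²` (e.g. the Frobenius one of `abs_dotProduct_mulVec_le`, or the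
  `∞`-norm one of `Literature.Analysis.InnerProduct.CholeskyResidualEigenvalueBounds`).

The reader-side twin (a certificate CONSUMER bounding `λ_min` of an exact matrix from a residual) is
`DyadicCholResidualWitness` / `PosSemidef.IsGramCertDD`; this file is about why an exact certificate near
the numerical optimum EXISTS and how it is written down.  Not here: continued-fraction rounding and the
LLL common-denominator variant (§3.1, App. B), Gauss–Seidel refinement, the Macaulay 2 package (§4).

## References

* H. Peyrl, P. A. Parrilo, *Computing sum of squares decompositions with rational coefficients*,
  Theoret. Comput. Sci. 409 (2) (2008) 269–281, doi:10.1016/j.tcs.2008.09.025. [PeyrlParrilo2008]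
* G. Blekherman, P. A. Parrilo, R. Thomas (eds.), *Semidefinite Optimization and Convex Algebraic
  Geometry*, SIAM 2012, §3.1.6 (context: rational SOS certificates). [BlekhermanParriloThomas2012]
-/

namespace Literature.Computation.Certificates.PeyrlParriloProjection

open Matrix Finset

section Field

variable {𝕜 : Type*} [Field 𝕜] {n ι : Type*} [Fintype n] [Fintype ι]

/-! ## §1 The trace form and the projection onto the constraint space -/

/-- The trace (Frobenius) pairing `⟪X, Y⟫ = Σ_{i,j} X_ij Y_ij = tr(Xᵀ Y)`; the paper's squared Euclidean
distance is `d(X, Y)² = frob (X − Y) (X − Y)`. [folklore] -/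
def frob (X Y : Matrix n n 𝕜) : 𝕜 := ∑ i, ∑ j, X i j * Y i j

/-- Symmetry of the trace pairing. [folklore] -/
private theorem frob_comm (X Y : Matrix n n 𝕜) : frob X Y = frob Y X := by
  simp only [frob, mul_comm]

/-- Additivity of the trace pairing in the first slot. [folklore] -/
private theorem frob_add_left (X Y Z : Matrix n n 𝕜) : frob (X + Y) Z = frob X Z + frob Y Z := by
  simp only [frob, Matrix.add_apply, add_mul, sum_add_distrib]

/-- The trace pairing respects subtraction in the first slot. [folklore] -/
private theorem frob_sub_left (X Y Z : Matrix n n 𝕜) : frob (X - Y) Z = frob X Z - frob Y Z := by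
  simp only [frob, Matrix.sub_apply, sub_mul, sum_sub_distrib]

/-- The trace pairing respects subtraction in the second slot. [folklore] -/
private theorem frob_sub_right (X Y Z : Matrix n n 𝕜) : frob Z (X - Y) = frob Z X - frob Z Y := by
  rw [frob_comm, frob_sub_left, frob_comm X, frob_comm Y]

/-- Homogeneity of the trace pairing in the first slot. [folklore] -/
private theorem frob_smul_left (c : 𝕜) (X Z : Matrix n n 𝕜) : frob (c • X) Z = c * frob X Z := by
  simp only [frob, Matrix.smul_apply, smul_eq_mul, mul_assoc, mul_sum]

/-- `⟪0, Z⟫ = 0`. [folklore] -/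
private theorem frob_zero_left (Z : Matrix n n 𝕜) : frob 0 Z = 0 := by
  simp [frob]

/-- The trace pairing commutes with finite sums in the first slot. [folklore] -/
private theorem frob_sum_left {β : Type*} (s : Finset β) (F : β → Matrix n n 𝕜) (Z : Matrix n n 𝕜) :
    frob (∑ l ∈ s, F l) Z = ∑ l ∈ s, frob (F l) Z := by
  classical
  induction s using Finset.induction_on with
  | empty => simp [frob_zero_left]
  | insert a s ha ih => rw [sum_insert ha, sum_insert ha, frob_add_left, ih]

/-- Linearity used throughout: `⟪Σ_l μ_l A_l, Z⟫ = Σ_l μ_l ⟪A_l, Z⟫`. [folklore] -/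
private theorem frob_sum_smul_left (μ : ι → 𝕜) (A : ι → Matrix n n 𝕜) (Z : Matrix n n 𝕜) :
    frob (∑ l, μ l • A l) Z = ∑ l, μ l * frob (A l) Z := by
  rw [frob_sum_left]
  simp only [frob_smul_left]

/-- `⟪−X, −Y⟫ = ⟪X, Y⟫`. [folklore] -/
private theorem frob_neg_neg (X Y : Matrix n n 𝕜) : frob (-X) (-Y) = frob X Y := by
  simp [frob]

/-- `d(X, Y)² = d(Y, X)²`. [folklore] -/
private theorem frob_sub_sub_comm (X Y : Matrix n n 𝕜) : frob (X - Y) (X - Y) = frob (Y - X) (Y - X) := by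
  rw [← neg_sub Y X, frob_neg_neg]

/-- `‖a + c‖² = ‖a‖² + 2⟪a, c⟫ + ‖c‖²` for the trace form. [folklore] -/
private theorem frob_add_add (a c : Matrix n n 𝕜) :
    frob (a + c) (a + c) = frob a a + 2 * frob a c + frob c c := by
  rw [frob_add_left, frob_comm a (a + c), frob_comm c (a + c), frob_add_left, frob_add_left, frob_comm c a]
  ring

/-- `‖a − c‖² = ‖a‖² − 2⟪a, c⟫ + ‖c‖²` for the trace form. [folklore] -/
private theorem frob_sub_sub (a c : Matrix n n 𝕜) :
    frob (a - c) (a - c) = frob a a - 2 * frob a c + frob c c := by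
  rw [frob_sub_left, frob_sub_right, frob_sub_right, frob_comm c a]
  ring

/-- **The projected matrix** `Π(Q) = Q − Σ_l μ_l • A_l`, where `μ` solves the normal equations
(`NormalEq`).  Only field operations on the data: rational in, rational out (Prop. 7, last sentence).
[cite: PeyrlParrilo2008, §3.1 Proposition 7, p. 276] -/
def proj (A : ι → Matrix n n 𝕜) (Q : Matrix n n 𝕜) (μ : ι → 𝕜) : Matrix n n 𝕜 :=
  Q - ∑ l, μ l • A l

/-- **Normal equations** of the orthogonal projection onto `L = {X : ∀ k, ⟪A_k, X⟫ = b_k}`: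
`Σ_l μ_l ⟪A_k, A_l⟫ = ⟪A_k, Q⟫ − b_k` for every `k` (the right-hand side is the paper's coefficient ERROR
`e` of the rounded matrix).  Any solution will do; no independence of the `A_k` is assumed.
[cite: PeyrlParrilo2008, §3.1 Proposition 7 and App. A, pp. 276, 279] -/
def NormalEq (A : ι → Matrix n n 𝕜) (b : ι → 𝕜) (Q : Matrix n n 𝕜) (μ : ι → 𝕜) : Prop :=
  ∀ k, ∑ l, μ l * frob (A k) (A l) = frob (A k) Q - b k

omit [Fintype n] in
/-- `Q − Π(Q) = Σ_l μ_l • A_l`. [folklore] -/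
private theorem sub_proj (A : ι → Matrix n n 𝕜) (Q : Matrix n n 𝕜) (μ : ι → 𝕜) :
    Q - proj A Q μ = ∑ l, μ l • A l := by
  rw [proj, sub_sub_cancel]

/-- `⟪A_k, Π(Q)⟫ = ⟪A_k, Q⟫ − Σ_l μ_l ⟪A_k, A_l⟫` (no hypothesis on `μ`). [folklore] -/
private theorem frob_constraint_proj_eq (A : ι → Matrix n n 𝕜) (Q : Matrix n n 𝕜) (μ : ι → 𝕜) (k : ι) :
    frob (A k) (proj A Q μ) = frob (A k) Q - ∑ l, μ l * frob (A k) (A l) := by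
  rw [proj, frob_sub_right, frob_comm (A k) (∑ l, μ l • A l), frob_sum_smul_left]
  simp only [frob_comm (A _) (A k)]

/-- **`Π(Q)` lies on `L` exactly** ("an orthogonal projection `Π` onto `L` will yield a rational matrix
`Π(Q̃)` satisfying (3)"): every affine constraint holds with equality, by the normal equations alone.
[cite: PeyrlParrilo2008, §3.1 Proposition 7, p. 276] -/
theorem frob_constraint_proj {A : ι → Matrix n n 𝕜} {b : ι → 𝕜} {Q : Matrix n n 𝕜} {μ : ι → 𝕜}
    (hμ : NormalEq A b Q μ) (k : ι) : frob (A k) (proj A Q μ) = b k := by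
  rw [frob_constraint_proj_eq, hμ k]
  ring

/-- **Proposition 7's closed form**: for a trace-ORTHOGONAL constraint family (`⟪A_k, A_l⟫ = 0`, `k ≠ l`,
`⟪A_k, A_k⟫ ≠ 0` — the coefficient-matching basis of an SOS program, `⟪A_γ, A_γ⟫ = n(γ)`), the normal
equations are solved by `μ_k = (⟪A_k, Q⟫ − b_k) / ⟪A_k, A_k⟫`: "subtracting the weighted errors of the
coefficients from the Gram matrix". [cite: PeyrlParrilo2008, §3.1 Proposition 7, p. 276] -/
theorem normalEq_of_orthogonal [DecidableEq ι] {A : ι → Matrix n n 𝕜} (b : ι → 𝕜) (Q : Matrix n n 𝕜)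
    (horth : ∀ k l, k ≠ l → frob (A k) (A l) = 0) (hne : ∀ k, frob (A k) (A k) ≠ 0) :
    NormalEq A b Q fun k ↦ (frob (A k) Q - b k) / frob (A k) (A k) := by
  intro k
  rw [sum_eq_single k (fun l _ hl ↦ by rw [horth k l (Ne.symm hl), mul_zero]) (by simp)]
  exact div_mul_cancel₀ _ (hne k)

/-- **Orthogonality** `Q − Π(Q) ⟂ (P − Π(Q))` for every `P ∈ L`: the correction lies in `span{A_l}`, and
each `A_l` pairs to `b_l − b_l = 0` against a difference of two feasible matrices.
[cite: PeyrlParrilo2008, §3.1 proof of Proposition 8, p. 276] -/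
theorem frob_sub_proj_orthogonal {A : ι → Matrix n n 𝕜} {b : ι → 𝕜} {Q P : Matrix n n 𝕜} {μ : ι → 𝕜}
    (hμ : NormalEq A b Q μ) (hP : ∀ k, frob (A k) P = b k) :
    frob (P - proj A Q μ) (Q - proj A Q μ) = 0 := by
  rw [sub_proj, frob_comm, frob_sum_smul_left]
  refine sum_eq_zero fun l _ ↦ ?_
  rw [frob_sub_right, hP l, frob_constraint_proj hμ l, sub_self, mul_zero]

/-- **Pythagoras** ("Since the projection … is orthogonal, … by Pythagoras' theorem"):
`d(P, Q)² = d(P, Π(Q))² + d(Q, Π(Q))²` for every `P ∈ L`.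
[cite: PeyrlParrilo2008, §3.1 proof of Proposition 8, p. 276] -/
theorem pythagoras {A : ι → Matrix n n 𝕜} {b : ι → 𝕜} {Q P : Matrix n n 𝕜} {μ : ι → 𝕜}
    (hμ : NormalEq A b Q μ) (hP : ∀ k, frob (A k) P = b k) :
    frob (P - Q) (P - Q) =
      frob (P - proj A Q μ) (P - proj A Q μ) + frob (Q - proj A Q μ) (Q - proj A Q μ) := by
  have h : P - Q = (P - proj A Q μ) - (Q - proj A Q μ) := by abel
  rw [h, frob_sub_sub, frob_sub_proj_orthogonal hμ hP]
  ring

/-- The difference of two projected matrices pairs to zero with every constraint matrix (both lie on `L`) —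
the step behind "Clearly, `d(Π(Q̃), Π(Q)) ≤ d(Q̃, Q)`". [cite: PeyrlParrilo2008, §3.1 proof of Proposition 8, p. 276] -/
theorem frob_constraint_proj_sub_proj {A : ι → Matrix n n 𝕜} {b : ι → 𝕜} {Q Q' : Matrix n n 𝕜}
    {μ μ' : ι → 𝕜} (hμ : NormalEq A b Q μ) (hμ' : NormalEq A b Q' μ') (k : ι) :
    frob (A k) (proj A Q μ - proj A Q' μ') = 0 := by
  rw [frob_sub_right, frob_constraint_proj hμ, frob_constraint_proj hμ', sub_self]

/-- Decomposition behind non-expansiveness: `Q − Q' = (Π(Q) − Π(Q')) + Σ_l (μ_l − μ'_l) • A_l`, the two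
parts trace-orthogonal, hence `d(Q, Q')² = d(Π(Q), Π(Q'))² + ‖Σ_l (μ_l − μ'_l) A_l‖²` (the identity behind the
paper's "Clearly, `d(Π(Q̃), Π(Q)) ≤ d(Q̃, Q)`"). [cite: PeyrlParrilo2008, §3.1 proof of Proposition 8, p. 276] -/
theorem frobSq_sub_eq_frobSq_proj_add {A : ι → Matrix n n 𝕜} {b : ι → 𝕜} {Q Q' : Matrix n n 𝕜}
    {μ μ' : ι → 𝕜} (hμ : NormalEq A b Q μ) (hμ' : NormalEq A b Q' μ') :
    frob (Q - Q') (Q - Q') =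
      frob (proj A Q μ - proj A Q' μ') (proj A Q μ - proj A Q' μ')
        + frob (∑ l, (μ l - μ' l) • A l) (∑ l, (μ l - μ' l) • A l) := by
  have hc : ∑ l, (μ l - μ' l) • A l = (Q - proj A Q μ) - (Q' - proj A Q' μ') := by
    rw [sub_proj, sub_proj, ← sum_sub_distrib]
    simp only [sub_smul]
  have h : Q - Q' = (proj A Q μ - proj A Q' μ') + ∑ l, (μ l - μ' l) • A l := by
    rw [hc]; abel
  have horth : frob (proj A Q μ - proj A Q' μ') (∑ l, (μ l - μ' l) • A l) = 0 := by
    rw [frob_comm, frob_sum_smul_left]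
    exact sum_eq_zero fun l _ ↦ by rw [frob_constraint_proj_sub_proj hμ hμ' l, mul_zero]
  rw [h, frob_add_add, horth]
  ring

omit [Fintype n] in
/-- `Π` maps symmetric data to a symmetric matrix (`Π : S^n → L ⊂ S^n` in the paper, which works in the space
`S^n` of symmetric matrices throughout). [cite: PeyrlParrilo2008, §3.1 Proposition 7, p. 276] -/
theorem isSymm_proj {A : ι → Matrix n n 𝕜} {Q : Matrix n n 𝕜} (μ : ι → 𝕜) (hQ : Q.IsSymm)
    (hA : ∀ l, (A l).IsSymm) : (proj A Q μ).IsSymm := by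
  refine Matrix.IsSymm.ext fun i j ↦ ?_
  simp only [proj, Matrix.sub_apply, Matrix.sum_apply, Matrix.smul_apply, hQ.apply i j, (hA _).apply i j]

/-- The quadratic form as a double sum. [folklore] -/
private theorem dotProduct_mulVec_eq_sum (M : Matrix n n 𝕜) (v : n → 𝕜) :
    v ⬝ᵥ (M *ᵥ v) = ∑ i, ∑ j, M i j * (v i * v j) := by
  simp only [dotProduct, mulVec, mul_sum]
  exact sum_congr rfl fun i _ ↦ sum_congr rfl fun j _ ↦ by ring

end Field

/-! ## §2 Inequalities over a linearly ordered field: nearest point, non-expansiveness, Propositions 8, 9 -/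

section Ordered

variable {𝕜 : Type*} [Field 𝕜] [LinearOrder 𝕜] [IsStrictOrderedRing 𝕜] {n ι : Type*} [Fintype n] [Fintype ι]

/-- `d(X, X)`-type squares are nonnegative: `0 ≤ ⟪X, X⟫`. [folklore] -/
private theorem frob_self_nonneg (X : Matrix n n 𝕜) : 0 ≤ frob X X :=
  sum_nonneg fun _ _ ↦ sum_nonneg fun _ _ ↦ mul_self_nonneg _

/-- **`Π(Q)` is the nearest point of `L`** in the trace form: `d(Q, Π(Q))² ≤ d(Q, P)²` for every `P ∈ L`
— the defining property of the paper's "orthogonal projection `Π`" (Fig. 1).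
[cite: PeyrlParrilo2008, §3.1 Proposition 7 and Fig. 1, p. 276] -/
theorem frobSq_proj_le {A : ι → Matrix n n 𝕜} {b : ι → 𝕜} {Q P : Matrix n n 𝕜} {μ : ι → 𝕜}
    (hμ : NormalEq A b Q μ) (hP : ∀ k, frob (A k) P = b k) :
    frob (Q - proj A Q μ) (Q - proj A Q μ) ≤ frob (P - Q) (P - Q) := by
  rw [pythagoras hμ hP]
  exact le_add_of_nonneg_left (frob_self_nonneg _)

/-- **Non-expansiveness** ("Clearly, `d(Π(Q̃), Π(Q)) ≤ d(Q̃, Q)`"): `d(Π(Q), Π(Q'))² ≤ d(Q, Q')²`.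
[cite: PeyrlParrilo2008, §3.1 proof of Proposition 8, p. 276] -/
theorem frobSq_proj_sub_proj_le {A : ι → Matrix n n 𝕜} {b : ι → 𝕜} {Q Q' : Matrix n n 𝕜}
    {μ μ' : ι → 𝕜} (hμ : NormalEq A b Q μ) (hμ' : NormalEq A b Q' μ') :
    frob (proj A Q μ - proj A Q' μ') (proj A Q μ - proj A Q' μ') ≤ frob (Q - Q') (Q - Q') := by
  rw [frobSq_sub_eq_frobSq_proj_add hμ hμ']
  exact le_add_of_nonneg_right (frob_self_nonneg _)

/-- **Cauchy–Schwarz surrogate for `|λ_i(E)| ≤ d(E, 0)`**: `(vᵀ E v)² ≤ ⟪E, E⟫ · (Σ vᵢ²)²`, with no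
symmetry, square root or eigenvalue needed. [cite: PeyrlParrilo2008, §3.1 proof of Proposition 8, p. 276] -/
theorem sq_dotProduct_mulVec_le (E : Matrix n n 𝕜) (v : n → 𝕜) :
    (v ⬝ᵥ (E *ᵥ v)) ^ 2 ≤ frob E E * (∑ i, v i ^ 2) ^ 2 := by
  have hcs := sum_mul_sq_le_sq_mul_sq (univ : Finset (n × n)) (fun p ↦ E p.1 p.2)
    (fun p ↦ v p.1 * v p.2)
  have h1 : ∑ p : n × n, E p.1 p.2 * (v p.1 * v p.2) = v ⬝ᵥ (E *ᵥ v) := by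
    rw [dotProduct_mulVec_eq_sum, ← Fintype.sum_prod_type']
  have h2 : ∑ p : n × n, E p.1 p.2 ^ 2 = frob E E := by
    rw [frob, ← Fintype.sum_prod_type']
    simp only [sq]
  have h3 : ∑ p : n × n, (v p.1 * v p.2) ^ 2 = (∑ i, v i ^ 2) ^ 2 := by
    rw [sq (∑ i, v i ^ 2), sum_mul_sum, ← Fintype.sum_prod_type']
    simp only [mul_pow]
  rw [h1, h2, h3] at hcs
  exact hcs

/-- `|vᵀ E v| ≤ ε · Σ vᵢ²` whenever `⟪E, E⟫ ≤ ε²`, `0 ≤ ε` — the exact form of `σ̄(E) ≤ d(E, 0) ≤ ε` used in the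
last display of the proof. [cite: PeyrlParrilo2008, §3.1 proof of Proposition 8, p. 276] -/
theorem abs_dotProduct_mulVec_le {E : Matrix n n 𝕜} {ε : 𝕜} (hE : frob E E ≤ ε ^ 2) (hε : 0 ≤ ε)
    (v : n → 𝕜) : |v ⬝ᵥ (E *ᵥ v)| ≤ ε * ∑ i, v i ^ 2 := by
  have hS : 0 ≤ ∑ i, v i ^ 2 := sum_nonneg fun i _ ↦ sq_nonneg _
  refine abs_le_of_sq_le_sq ?_ (mul_nonneg hε hS)
  calc (v ⬝ᵥ (E *ᵥ v)) ^ 2 ≤ frob E E * (∑ i, v i ^ 2) ^ 2 := sq_dotProduct_mulVec_le E v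
    _ ≤ ε ^ 2 * (∑ i, v i ^ 2) ^ 2 := mul_le_mul_of_nonneg_right hE (sq_nonneg _)
    _ = (ε * ∑ i, v i ^ 2) ^ 2 := by ring

/-- **The margin lemma** (the last display of the proof of Prop. 8): if `vᵀQv ≥ ε Σvᵢ²` for all `v` and
`d(Q', Q)² ≤ ε²`, then `vᵀQ'v ≥ 0` for all `v` — `Q' = Q + (Q' − Q) ⪰ ε·I − σ̄(Q' − Q)·I ⪰ 0`.
[cite: PeyrlParrilo2008, §3.1 proof of Proposition 8, p. 276] -/
theorem dotProduct_mulVec_nonneg_of_margin {Q Q' : Matrix n n 𝕜} {ε : 𝕜} (hε : 0 ≤ ε)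
    (hQ : ∀ v : n → 𝕜, ε * ∑ i, v i ^ 2 ≤ v ⬝ᵥ (Q *ᵥ v)) (hE : frob (Q' - Q) (Q' - Q) ≤ ε ^ 2)
    (v : n → 𝕜) : 0 ≤ v ⬝ᵥ (Q' *ᵥ v) := by
  have h1 := hQ v
  have h2 := (abs_le.mp (abs_dotProduct_mulVec_le hE hε v)).1
  have h3 : v ⬝ᵥ (Q' *ᵥ v) = v ⬝ᵥ (Q *ᵥ v) + v ⬝ᵥ ((Q' - Q) *ᵥ v) := by
    rw [sub_mulVec, dotProduct_sub]; ring
  rw [h3]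
  linarith

/-- **Peyrl–Parrilo, Proposition 8.**  Data: constraint matrices `A_k` with right-hand sides `b_k`
(`L = {X : ⟪A_k, X⟫ = b_k}`); the numerical solution `Q` with margin `ε ≥ 0` (`vᵀQv ≥ ε Σvᵢ²`, i.e.
`Q ⪰ ε·I`) at squared distance `≤ δ²` from its projection `Π(Q)`; the rounded matrix `Q̃` with
`d(Q, Q̃)² ≤ τ²`; `μ`, `μ̃` any solutions of the respective normal equations.  "Assume `τ² + δ² ≤ ε²`.
Then, the orthogonal projection of the rounded matrix `Q̃` on the affine subspace `L` is positive
semidefinite" — and it lies on `L` exactly.  (Over `𝕜 = ℚ` every hypothesis and the conclusion are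
statements of exact arithmetic; `Q` itself never needs to be known exactly beyond the three bounds.)
[cite: PeyrlParrilo2008, §3.1 Proposition 8, p. 276] -/
theorem proposition8 {A : ι → Matrix n n 𝕜} {b : ι → 𝕜} {Q Qt : Matrix n n 𝕜} {μ μt : ι → 𝕜}
    {ε δ τ : 𝕜} (hμ : NormalEq A b Q μ) (hμt : NormalEq A b Qt μt) (hε : 0 ≤ ε)
    (hQ : ∀ v : n → 𝕜, ε * ∑ i, v i ^ 2 ≤ v ⬝ᵥ (Q *ᵥ v))
    (hδ : frob (Q - proj A Q μ) (Q - proj A Q μ) ≤ δ ^ 2)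
    (hτ : frob (Q - Qt) (Q - Qt) ≤ τ ^ 2) (h : τ ^ 2 + δ ^ 2 ≤ ε ^ 2) :
    (∀ k, frob (A k) (proj A Qt μt) = b k) ∧ ∀ v : n → 𝕜, 0 ≤ v ⬝ᵥ (proj A Qt μt *ᵥ v) := by
  refine ⟨frob_constraint_proj hμt, dotProduct_mulVec_nonneg_of_margin hε hQ ?_⟩
  -- `d(Π(Q̃), Q)² = d(Π(Q̃), Π(Q))² + d(Q, Π(Q))² ≤ d(Q̃, Q)² + δ² ≤ τ² + δ² ≤ ε²`
  have hp := pythagoras hμ (frob_constraint_proj hμt)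
  have hne := frobSq_proj_sub_proj_le hμt hμ
  have hs := frob_sub_sub_comm Qt Q
  linarith

/-- **Proposition 8, `Matrix.PosSemidef` form** (symmetric data; any linearly ordered field with trivial
star, e.g. `ℚ` or `ℝ`): `Π(Q̃)` is positive semidefinite and satisfies the constraints exactly — "thus it
is a valid SOS decomposition". [cite: PeyrlParrilo2008, §3.1 Proposition 8, p. 276] -/
theorem posSemidef_proj [StarRing 𝕜] [TrivialStar 𝕜] {A : ι → Matrix n n 𝕜} {b : ι → 𝕜}
    {Q Qt : Matrix n n 𝕜} {μ μt : ι → 𝕜} {ε δ τ : 𝕜} (hμ : NormalEq A b Q μ)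
    (hμt : NormalEq A b Qt μt) (hQt : Qt.IsSymm) (hA : ∀ l, (A l).IsSymm) (hε : 0 ≤ ε)
    (hQ : ∀ v : n → 𝕜, ε * ∑ i, v i ^ 2 ≤ v ⬝ᵥ (Q *ᵥ v))
    (hδ : frob (Q - proj A Q μ) (Q - proj A Q μ) ≤ δ ^ 2)
    (hτ : frob (Q - Qt) (Q - Qt) ≤ τ ^ 2) (h : τ ^ 2 + δ ^ 2 ≤ ε ^ 2) :
    (proj A Qt μt).PosSemidef ∧ ∀ k, frob (A k) (proj A Qt μt) = b k := by
  obtain ⟨hfeas, hpsd⟩ := proposition8 hμ hμt hε hQ hδ hτ h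
  exact ⟨.of_dotProduct_mulVec_nonneg (isHermitian_iff_isSymm.2 (isSymm_proj μt hQt hA))
    fun x ↦ by simpa only [star_trivial] using hpsd x, hfeas⟩

/-- **Peyrl–Parrilo, Proposition 9 (image representation).**  `Q(y) = G₀ + Σ_l y_l • G_l` satisfies the
polynomial identity for EVERY `y` ("since the base matrices `Gᵢ` are exact"), so only semidefiniteness
is at stake: if `Q(y) ⪰ ε·I`, `|y_l − ỹ_l| ≤ τ` and `τ · Σ_l s_l ≤ ε`, where `s_l` bounds the numerical
radius of `G_l` (`|vᵀG_lv| ≤ s_l Σvᵢ²`; the paper takes `s_l = σ̄(G_l) = max_i |λ_i(G_l)|`, any certified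
bound serves), then `Q(ỹ) ⪰ 0`: "the rational approximation `ỹ` will yield an exact SOS decomposition".
[cite: PeyrlParrilo2008, §3.2 Proposition 9, p. 277] -/
theorem proposition9 {m : Type*} [Fintype m] (G₀ : Matrix n n 𝕜) (G : m → Matrix n n 𝕜)
    {y yt : m → 𝕜} {s : m → 𝕜} {ε τ : 𝕜}
    (hQ : ∀ v : n → 𝕜, ε * ∑ i, v i ^ 2 ≤ v ⬝ᵥ ((G₀ + ∑ l, y l • G l) *ᵥ v))
    (hs : ∀ l (v : n → 𝕜), |v ⬝ᵥ (G l *ᵥ v)| ≤ s l * ∑ i, v i ^ 2)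
    (hy : ∀ l, |yt l - y l| ≤ τ) (hτ : τ * ∑ l, s l ≤ ε) (v : n → 𝕜) :
    0 ≤ v ⬝ᵥ ((G₀ + ∑ l, yt l • G l) *ᵥ v) := by
  have hS : 0 ≤ ∑ i, v i ^ 2 := sum_nonneg fun i _ ↦ sq_nonneg _
  -- `Q(ỹ) = Q(y) + Σ_l (ỹ_l − y_l) • G_l`
  have hsplit : G₀ + ∑ l, yt l • G l = (G₀ + ∑ l, y l • G l) + ∑ l, (yt l - y l) • G l := by
    rw [add_assoc, ← sum_add_distrib]
    congr 1
    exact sum_congr rfl fun l _ ↦ by rw [sub_smul, add_sub_cancel]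
  have hlin : v ⬝ᵥ ((∑ l, (yt l - y l) • G l) *ᵥ v) = ∑ l, (yt l - y l) * (v ⬝ᵥ (G l *ᵥ v)) := by
    rw [sum_mulVec, dotProduct_sum]
    exact sum_congr rfl fun l _ ↦ by rw [smul_mulVec, dotProduct_smul, smul_eq_mul]
  -- each term is at least `−τ s_l Σvᵢ²`
  have hterm : ∀ l, -(τ * s l * ∑ i, v i ^ 2) ≤ (yt l - y l) * (v ⬝ᵥ (G l *ᵥ v)) := by
    intro l
    have h1 : |(yt l - y l) * (v ⬝ᵥ (G l *ᵥ v))| ≤ τ * (s l * ∑ i, v i ^ 2) := by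
      rw [abs_mul]
      exact mul_le_mul (hy l) (hs l v) (abs_nonneg _) ((abs_nonneg _).trans (hy l))
    have h2 := (abs_le.mp h1).1
    linarith
  have hsum : -(τ * (∑ l, s l) * ∑ i, v i ^ 2) ≤ ∑ l, (yt l - y l) * (v ⬝ᵥ (G l *ᵥ v)) := by
    have := sum_le_sum fun l (_ : l ∈ (univ : Finset m)) ↦ hterm l
    rw [sum_neg_distrib] at this
    have hre : ∑ l, τ * s l * ∑ i, v i ^ 2 = τ * (∑ l, s l) * ∑ i, v i ^ 2 := by
      rw [← sum_mul, ← mul_sum]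
    linarith
  have hτS : τ * (∑ l, s l) * ∑ i, v i ^ 2 ≤ ε * ∑ i, v i ^ 2 := mul_le_mul_of_nonneg_right hτ hS
  rw [hsplit, add_mulVec, dotProduct_add, hlin]
  linarith [hQ v]

end Ordered

/-! ## §3 A worked instance over `ℚ` (everything above is exact arithmetic there) -/

section Example

/-- One constraint `⟪A, X⟫ = 2` with `A = [[0,1],[1,0]]` (the sum of the off-diagonal entries), rounded
matrix `Q̃ = [[2, 9/10], [9/10, 2]]` (error `e = 9/5 − 2 = −1/5`, `n = ⟪A, A⟫ = 2`): Proposition 7's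
weight is `μ = e / n = −1/10` and `Π(Q̃) = Q̃ + (1/10)·A = [[2, 1], [1, 2]]`, on `L` exactly. -/
example :
    proj (fun _ : Unit ↦ !![(0 : ℚ), 1; 1, 0]) !![2, 9/10; 9/10, 2] (fun _ ↦ -1/10) = !![2, 1; 1, 2] := by
  ext i j
  fin_cases i <;> fin_cases j <;> norm_num [proj]

example : NormalEq (fun _ : Unit ↦ !![(0 : ℚ), 1; 1, 0]) (fun _ ↦ 2) !![2, 9/10; 9/10, 2]
    (fun _ ↦ -1/10) := by
  intro k
  simp [frob, Fin.sum_univ_two]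
  norm_num

end Example

end Literature.Computation.Certificates.PeyrlParriloProjection
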